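/-
Copyright (c) 2026. All rights reserved.
Released under Apache 2.0 license as described in the file LICENSE.
-/
import Literature.AlgebraicGeometry.Pohlmann1968.DegenerateCMTypesCyclicCMFieldPrimePowerCount
import HarnessLib

/-!
# The prime cyclotomic fields `ℚ(ζ_ℓ)` with `ℓ − 1 = 2p^k`: simple abelian `p^k`-folds with complex multiplication
# by `ℚ(ζ₁₆₃)`, `ℚ(ζ₂₅₁)`, `ℚ(ζ₄₈₇)` — ranks, the Hodge conjecture for powers, existence, counts

Instances of the cyclic theory (`DegenerateCMTypesCyclicCMFieldPrimePower`, `…Existence`, `…Count`): for a prime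
`ℓ` with `ℓ − 1 = 2p^{m+1}` (`p` odd) the cyclotomic field `ℚ(ζ_ℓ)` is a CM field with CYCLIC Galois group of
order `2p^{m+1}` (tree `cm_normal_cyclic_finrank_of_prime`), so: a CM type is the type of simple abelian
`p^{m+1}`-folds iff its rank exceeds `p^m + 1`, and then it is at least `φ(p^{m+1}) + 2`; rank `p^{m+1} + 1` gives
the Hodge conjecture for all powers, the other simple ones carry explicit exceptional classes; simple abelian
`p^{m+1}`-folds of each rank `p^{m+1} + 1`, `φ(p^{m+1}) + 2`, `p^{m+1} + 1 − φ(p^{i+1})` (`i < m`) exist (Shimura);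
`2^{p^{m+1}}` CM types, `2^{p^m}` non-primitive.  B. B. Gordon [Gordon1999HodgeAVSurvey], 9.4.2 treats `ℚ(ζ_p)`
(Ribet–Lenstra–Stark examples) and `ℚ(ζ₁₉)` (Serre); B. Dodson [Dodson1987], Remark 4.5, the existence of simple
abelian varieties of prescribed dimension and rank via solvable CM fields.  THEOREMS ONLY.

## What is proved

* **`prime_cyclotomic`** (`ℓ − 1 = 2p^{m+1}`): simplicity criterion, the bound `φ(p^{m+1}) + 2`, the dichotomy,
  existence of each listed rank, the counts.
* **`eightyOne_folds_zeta163`** (`ℚ(ζ₁₆₃)`, `162 = 2·3⁴`: simple `81`-folds have rank `> 28`, `≥ 56`; rank `82` ⟹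
  HC for all powers; ranks `82, 80, 76, 64, 56` occur; `2⁸¹` CM types, `2²⁷` non-primitive),
  **`oneHundredTwentyFive_folds_zeta251`** (`ℚ(ζ₂₅₁)`, `250 = 2·5³`: rank `> 26`, `≥ 102`; `126` ⟹ HC for all
  powers; ranks `126, 122, 106, 102` occur; `2¹²⁵` types, `2²⁵` non-primitive),
  **`twoHundredFortyThree_folds_zeta487`** (`ℚ(ζ₄₈₇)`, `486 = 2·3⁵`: rank `> 82`, `≥ 164`; ranks
  `244, 242, 238, 226, 190, 164` occur).

## References

* [Dodson1987] B. Dodson, J. Algebra 111 (1987), Prop. 4.4 (1), Remark 4.5.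
* [Gordon1999HodgeAVSurvey] B. B. Gordon, 9.4.2, Thm. 6.4, 9.2.2.
* [Washington1997] L. Washington, *Introduction to cyclotomic fields*, Thm. 2.5.
* [Shimura1998] G. Shimura, §6.2 Thm. 3, §8.2 Prop. 26.

## Provenance

Lane `lit-hodgefound` (Track 2, Layer A3/B), seat `lit-hodgefound-p10` generation 35, row g35-#17; neighbours
cited by name, nothing restated: `DegenerateCMTypesCyclicCMFieldPrimePower` (`isPrimitive_iff_of_isCyclic`,
`hodgeConjectureFor_pow_or_exceptional_of_isCyclic`), `…Existence` (`exists_realisation_cmTypeRank_eq_of_isCyclic`),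
`…Count` (`counts_of_isCyclic`), `CyclicTimesPrimeCMTypesField` (`cm_normal_cyclic_finrank_of_prime`).
-/

open scoped BigOperators NumberField IsMulCommutative Classical
open CategoryTheory NumberField

namespace Literature.AlgebraicGeometry.Pohlmann1968

namespace CyclicPrimePower

open Literature.NumberTheory.ComplexMultiplication
open Literature.AlgebraicGeometry.Motives (AbelianVariety CMType)
open Literature.AlgebraicGeometry.HodgeTheory
open Literature.AlgebraicGeometry.VanGeemen1994 (hodgeClassSpan)
open Literature.AlgebraicGeometry.ComplexMultiplication (IsCMTypeRealisation isSimple_iff_isPrimitive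
  exists_isCMTypeRealisation)
open Literature.Barriers.HodgeConjecture (divisorClassesSpan)
open Literature.AlgebraicGeometry.ComplexMultiplication.CyclicTwoPower (cm_normal_cyclic_finrank_of_prime)

/-! ## §1 The prime cyclotomic fields `ℚ(ζ_ℓ)` with `ℓ − 1 = 2p^k` -/

section PrimeCyclotomic


/-- **`ℚ(ζ_ℓ)`, `ℓ` prime with `ℓ − 1 = 2p^{m+1}` (`p` odd): the simple abelian `p^{m+1}`-folds with complex
multiplication by `ℚ(ζ_ℓ)`** — (1) a CM type is the type of SIMPLE abelian varieties iff its rank exceeds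
`p^m + 1`, and then the rank is at least `φ(p^{m+1}) + 2`; (2) rank `p^{m+1} + 1` (nondegenerate) gives the Hodge
conjecture for all powers, any other simple `A` carries a rational `(p^{m−i}, p^{m−i})`-class outside `D`;
(3) simple abelian `p^{m+1}`-folds of each rank `p^{m+1} + 1`, `φ(p^{m+1}) + 2`, `p^{m+1} + 1 − φ(p^{i+1})`
(`i < m`) EXIST; (4) `2^{p^{m+1}}` CM types, `2^{p^m}` of them non-primitive.
[cite: Dodson1987, Prop. 4.4 (1) and Remark 4.5] [cite: Gordon1999HodgeAVSurvey, 9.4.2, Thm. 6.4 and 9.2.2]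
[cite: Washington1997, Thm. 2.5] [cite: Shimura1998, §6.2 Theorem 3 and §8.2 Prop. 26] -/
theorem prime_cyclotomic {ℓ p m : ℕ} (hℓ : ℓ.Prime) (hp : p.Prime) (hp2 : p ≠ 2) (hℓp : ℓ - 1 = 2 * p ^ (m + 1))
    (L : Type) [Field L] [NumberField L] [IsCyclotomicExtension {ℓ} ℚ L] (φh : L →+* ℂ) :
    (∀ (Φ : CMType L) (A : AbelianVariety ℂ) (ι : 𝓞 L →+* End A) (θ : L →+* Module.End ℂ (complexBetti A.X 1)),
      IsCMTypeRealisation Φ A ι θ →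
        (A.IsSimple ↔ p ^ m + 1 < cmTypeRank Φ) ∧
        (A.IsSimple → p ^ (m + 1) - p ^ m + 2 ≤ cmTypeRank Φ) ∧
        (A.IsSimple → (IsNondegenerate Φ ∧
            ∀ n : ℕ, HodgeConjectureFor (⨁ fun _ : Fin n => A).dim (⨁ fun _ : Fin n => A).X) ∨
          (¬ IsNondegenerate Φ ∧ ∃ i : ℕ, i + 1 < m + 1 ∧
            ∃ c : complexBetti A.X (2 * p ^ (m + 1 - (i + 1))), IsRationalClass c ∧
              IsOfHodgeType (p ^ (m + 1)) A.X (2 * p ^ (m + 1 - (i + 1))) (p ^ (m + 1 - (i + 1)))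
                (p ^ (m + 1 - (i + 1))) c ∧
              c ∉ divisorClassesSpan A.X (p ^ (m + 1)) (p ^ (m + 1 - (i + 1)))))) ∧
    (∀ r : ℕ, (r = p ^ (m + 1) + 1 ∨ r = p ^ (m + 1) - p ^ m + 2 ∨
        ∃ i₀ < m, r + (p ^ (i₀ + 1) - p ^ i₀) = p ^ (m + 1) + 1) →
      ∃ (Φ : CMType L) (A : AbelianVariety ℂ) (ι : 𝓞 L →+* End A) (θ : L →+* Module.End ℂ (complexBetti A.X 1)),
        IsCMTypeRealisation Φ A ι θ ∧ A.IsSimple ∧ A.dim = p ^ (m + 1) ∧ cmTypeRank Φ = r) ∧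
    (Set.univ : Set (CMType L)).ncard = 2 ^ (p ^ (m + 1)) ∧
    {Φ : CMType L | ¬ IsPrimitive (ℂ ≃+* ℂ) Φ.1 φh}.ncard = 2 ^ (p ^ m) := by
  have h2ℓ : 2 < ℓ := by
    have := hℓ.two_le
    have hpos : 0 < p ^ (m + 1) := pow_pos hp.pos _
    omega
  obtain ⟨hcm, hno, hcyc, hL⟩ := cm_normal_cyclic_finrank_of_prime hℓ h2ℓ L
  haveI := hcm
  haveI := hno
  have hK : Module.finrank ℚ L = 2 * p ^ (m + 1) := by rw [hL, hℓp]
  refine ⟨fun Φ A ι θ hA => ?_, fun r hr => exists_realisation_cmTypeRank_eq_of_isCyclic hcyc hp hp2 hK r hr,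
    (counts_of_isCyclic hcyc hp hp2 hK φh).1, (counts_of_isCyclic hcyc hp hp2 hK φh).2.1⟩
  have hpr := isPrimitive_iff_of_isCyclic hcyc hp hp2 hK Φ φh
  rw [isSimple_iff_isPrimitive hA φh]
  refine ⟨hpr.1, hpr.2, fun hs => ?_⟩
  rcases hodgeConjectureFor_pow_or_exceptional_of_isCyclic hcyc hp hp2 hK Φ hA
      ((isSimple_iff_isPrimitive hA φh).2 hs) with ⟨hnd, -, hall⟩ | ⟨hnd, hex⟩
  · exact Or.inl ⟨hnd, hall⟩
  · exact Or.inr ⟨hnd, hex⟩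

end PrimeCyclotomic

/-! ## §2 `ℚ(ζ₁₆₃)`: simple abelian `81`-folds (`p = 3`, `k = 4`) -/

section Examples

/-- **`ℚ(ζ₁₆₃)`** (`163` prime, `162 = 2·3⁴`): simple abelian `81`-folds with CM by `ℚ(ζ₁₆₃)` have rank `> 28`,
indeed `≥ 56 = φ(81) + 2`; rank `82` gives the Hodge conjecture for all powers; simple `81`-folds of each rank
`82, 80, 76, 64, 56` exist; `2⁸¹` CM types, `2²⁷` non-primitive. [cite: Dodson1987, Remark 4.5]
[cite: Gordon1999HodgeAVSurvey, 9.4.2 and Thm. 6.4] [cite: Washington1997, Thm. 2.5] -/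
theorem eightyOne_folds_zeta163 (L : Type) [Field L] [NumberField L] [IsCyclotomicExtension {163} ℚ L]
    (φh : L →+* ℂ) :
    (∀ (Φ : CMType L) (A : AbelianVariety ℂ) (ι : 𝓞 L →+* End A) (θ : L →+* Module.End ℂ (complexBetti A.X 1)),
      IsCMTypeRealisation Φ A ι θ →
        (A.IsSimple ↔ 28 < cmTypeRank Φ) ∧ (A.IsSimple → 56 ≤ cmTypeRank Φ) ∧
        (A.IsSimple → cmTypeRank Φ = 82 →
          ∀ n : ℕ, HodgeConjectureFor (⨁ fun _ : Fin n => A).dim (⨁ fun _ : Fin n => A).X)) ∧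
    (∀ r ∈ ({82, 80, 76, 64, 56} : Finset ℕ),
      ∃ (Φ : CMType L) (A : AbelianVariety ℂ) (ι : 𝓞 L →+* End A) (θ : L →+* Module.End ℂ (complexBetti A.X 1)),
        IsCMTypeRealisation Φ A ι θ ∧ A.IsSimple ∧ A.dim = 81 ∧ cmTypeRank Φ = r) ∧
    (Set.univ : Set (CMType L)).ncard = 2 ^ 81 ∧
    {Φ : CMType L | ¬ IsPrimitive (ℂ ≃+* ℂ) Φ.1 φh}.ncard = 2 ^ 27 := by
  obtain ⟨h1, h2, h3, h4⟩ := prime_cyclotomic (ℓ := 163) (p := 3) (m := 3) (by norm_num) Nat.prime_three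
    (by norm_num) (by norm_num) L φh
  refine ⟨fun Φ A ι θ hA => ?_, fun r hr => ?_, by simpa using h3, by simpa using h4⟩
  · obtain ⟨hs, hb, hd⟩ := h1 Φ A ι θ hA
    refine ⟨by simpa using hs, fun h => by simpa using hb h, fun h hr n => ?_⟩
    rcases hd h with ⟨-, hall⟩ | ⟨hnd, -⟩
    · exact hall n
    · exfalso; apply hnd
      obtain ⟨hcm, -, -, hL⟩ := cm_normal_cyclic_finrank_of_prime (p := 163) (by norm_num) (by norm_num) L
      haveI := hcm
      rw [_root_.Literature.AlgebraicGeometry.Pohlmann1968.isNondegenerate_iff, hL, hr]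
  · have := h2 r
    simp only [Finset.mem_insert, Finset.mem_singleton] at hr
    have h81 : (3 : ℕ) ^ (3 + 1) = 81 := by norm_num
    rw [h81] at this
    apply this
    rcases hr with rfl | rfl | rfl | rfl | rfl
    · left; norm_num
    · right; right; exact ⟨0, by norm_num, by norm_num⟩
    · right; right; exact ⟨1, by norm_num, by norm_num⟩
    · right; right; exact ⟨2, by norm_num, by norm_num⟩
    · right; left; norm_num

/-- **`ℚ(ζ₂₅₁)`** (`251` prime, `250 = 2·5³`): simple abelian `125`-folds with CM by `ℚ(ζ₂₅₁)` have rank `> 26`,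
indeed `≥ 102 = φ(125) + 2`; rank `126` gives the Hodge conjecture for all powers; simple `125`-folds of each rank
`126, 122, 106, 102` exist; `2¹²⁵` CM types, `2²⁵` non-primitive. [cite: Dodson1987, Remark 4.5]
[cite: Gordon1999HodgeAVSurvey, 9.4.2 and Thm. 6.4] [cite: Washington1997, Thm. 2.5] -/
theorem oneHundredTwentyFive_folds_zeta251 (L : Type) [Field L] [NumberField L]
    [IsCyclotomicExtension {251} ℚ L] (φh : L →+* ℂ) :
    (∀ (Φ : CMType L) (A : AbelianVariety ℂ) (ι : 𝓞 L →+* End A) (θ : L →+* Module.End ℂ (complexBetti A.X 1)),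
      IsCMTypeRealisation Φ A ι θ →
        (A.IsSimple ↔ 26 < cmTypeRank Φ) ∧ (A.IsSimple → 102 ≤ cmTypeRank Φ) ∧
        (A.IsSimple → cmTypeRank Φ = 126 →
          ∀ n : ℕ, HodgeConjectureFor (⨁ fun _ : Fin n => A).dim (⨁ fun _ : Fin n => A).X)) ∧
    (∀ r ∈ ({126, 122, 106, 102} : Finset ℕ),
      ∃ (Φ : CMType L) (A : AbelianVariety ℂ) (ι : 𝓞 L →+* End A) (θ : L →+* Module.End ℂ (complexBetti A.X 1)),
        IsCMTypeRealisation Φ A ι θ ∧ A.IsSimple ∧ A.dim = 125 ∧ cmTypeRank Φ = r) ∧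
    (Set.univ : Set (CMType L)).ncard = 2 ^ 125 ∧
    {Φ : CMType L | ¬ IsPrimitive (ℂ ≃+* ℂ) Φ.1 φh}.ncard = 2 ^ 25 := by
  have h5 : Nat.Prime 5 := by norm_num
  obtain ⟨h1, h2, h3, h4⟩ := prime_cyclotomic (ℓ := 251) (p := 5) (m := 2) (by norm_num) h5
    (by norm_num) (by norm_num) L φh
  refine ⟨fun Φ A ι θ hA => ?_, fun r hr => ?_, by simpa using h3, by simpa using h4⟩
  · obtain ⟨hs, hb, hd⟩ := h1 Φ A ι θ hA
    refine ⟨by simpa using hs, fun h => by simpa using hb h, fun h hr n => ?_⟩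
    rcases hd h with ⟨-, hall⟩ | ⟨hnd, -⟩
    · exact hall n
    · exfalso; apply hnd
      obtain ⟨hcm, -, -, hL⟩ := cm_normal_cyclic_finrank_of_prime (p := 251) (by norm_num) (by norm_num) L
      haveI := hcm
      rw [_root_.Literature.AlgebraicGeometry.Pohlmann1968.isNondegenerate_iff, hL, hr]
  · have := h2 r
    simp only [Finset.mem_insert, Finset.mem_singleton] at hr
    have h125 : (5 : ℕ) ^ (2 + 1) = 125 := by norm_num
    rw [h125] at this
    apply this
    rcases hr with rfl | rfl | rfl | rfl
    · left; norm_num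
    · right; right; exact ⟨0, by norm_num, by norm_num⟩
    · right; right; exact ⟨1, by norm_num, by norm_num⟩
    · right; left; norm_num

/-- **`ℚ(ζ₄₈₇)`** (`487` prime, `486 = 2·3⁵`): simple abelian `243`-folds with CM by `ℚ(ζ₄₈₇)` have rank `> 82`,
indeed `≥ 164 = φ(243) + 2`; simple `243`-folds of each rank `244, 242, 238, 226, 190, 164` exist.
[cite: Dodson1987, Remark 4.5] [cite: Gordon1999HodgeAVSurvey, 9.4.2] [cite: Washington1997, Thm. 2.5] -/
theorem twoHundredFortyThree_folds_zeta487 (L : Type) [Field L] [NumberField L]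
    [IsCyclotomicExtension {487} ℚ L] (φh : L →+* ℂ) :
    (∀ (Φ : CMType L) (A : AbelianVariety ℂ) (ι : 𝓞 L →+* End A) (θ : L →+* Module.End ℂ (complexBetti A.X 1)),
      IsCMTypeRealisation Φ A ι θ → (A.IsSimple ↔ 82 < cmTypeRank Φ) ∧ (A.IsSimple → 164 ≤ cmTypeRank Φ)) ∧
    (∀ r ∈ ({244, 242, 238, 226, 190, 164} : Finset ℕ),
      ∃ (Φ : CMType L) (A : AbelianVariety ℂ) (ι : 𝓞 L →+* End A) (θ : L →+* Module.End ℂ (complexBetti A.X 1)),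
        IsCMTypeRealisation Φ A ι θ ∧ A.IsSimple ∧ A.dim = 243 ∧ cmTypeRank Φ = r) := by
  obtain ⟨h1, h2, -, -⟩ := prime_cyclotomic (ℓ := 487) (p := 3) (m := 4) (by norm_num) Nat.prime_three
    (by norm_num) (by norm_num) L φh
  refine ⟨fun Φ A ι θ hA => ?_, fun r hr => ?_⟩
  · obtain ⟨hs, hb, -⟩ := h1 Φ A ι θ hA
    exact ⟨by simpa using hs, fun h => by simpa using hb h⟩
  · have := h2 r
    simp only [Finset.mem_insert, Finset.mem_singleton] at hr
    have h243 : (3 : ℕ) ^ (4 + 1) = 243 := by norm_num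
    rw [h243] at this
    apply this
    rcases hr with rfl | rfl | rfl | rfl | rfl | rfl
    · left; norm_num
    · right; right; exact ⟨0, by norm_num, by norm_num⟩
    · right; right; exact ⟨1, by norm_num, by norm_num⟩
    · right; right; exact ⟨2, by norm_num, by norm_num⟩
    · right; right; exact ⟨3, by norm_num, by norm_num⟩
    · right; left; norm_num

end Examples

end CyclicPrimePower

end Literature.AlgebraicGeometry.Pohlmann1968
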